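import Summits.ResolutionOfSingularities.ResolutionOfSingularities.Theorems.EquisingularLiftEquisingularLiftNatNodalCurveLiftOfGE
import Summits.ResolutionOfSingularities.ResolutionOfSingularities.Theorems.EquisingularLiftEquisingularLiftNatEmbeddedLiftOfFirstOrderAt
import HarnessLib

/-!
# [OURS · L1 W4.5(b) · EL♮(3) · S-D8-LIFT / RULING R70 (ii) TWIN-2] THE NODAL LIFT RESIDUE AND `NodalHostedRoundFact` MODULO GROTHENDIECK EXISTENCE FOR
# PRINCIPAL IDEALS OF DEFINITION (E♭'s shape) — `nodalCurveLiftFact_of_grothendieckExistencePrincipal`, `nodalHostedRoundFact_of_grothendieckExistencePrincipal`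

res-L1-w45b-stub-4 g14 (TWIN-2 owner by desk RULING R70 (ii) 2026-08-29T05:37:22Z; author of ✓ `nodalCurveLiftFact_of_grothendieckExistence` /
✓ `nodalHostedRoundFact_of_grothendieckExistence`, …NatNodalCurveLiftOfGE, whose statements and proof this file repeats with ONE change), over
res-L1-w45b-nose-w1 g5's TWIN-2 half ✓ `exists_flat_lift_of_firstOrder_of_principal` (…NatEmbeddedLiftOfFirstOrderAt).  OURS; NOT a statement of any
manuscript ([Hironaka2017] is a candidate under adjudication, nothing of it is asserted); AI-written, weaker than expert review.  No `sorry`; standard axioms;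
DEF-FREE; NO named-fact hypothesis — the Grothendieck-existence input is carried as the INLINE hypothesis `hGEp` in E♭'s shape (res-inputs-crit-1's custody
shape: F-88's body `GrothendieckExistence` with `(I : Ideal A) [IsAdicComplete I A]` ↦ `(a : A) [IsAdicComplete (Ideal.span {a}) A]`, `I` ↦ `Ideal.span {a}`,
universe `0`), byte-identical to nose-w1's `hGEp`.  `--supports stmt-ResolutionOfSingularities-20148 --as helper`, counted 0.  EL♮(3) is NOT proved; F-88 is
NOT paid by this file; resolution of singularities in positive characteristic is NOT proved.

WHY.  R70 (ii) audit (bus 2026-08-29T05:39:20Z): the cone of ✓ `nodalHostedRoundFact_of_grothendieckExistence` applies the named fact `GrothendieckExistence`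
(F-88 = Görtz–Wedhorn II Prop. 24.109 / EGA III₁ 5.1.4, typed by us as a `def … : Prop`, never asserted) exactly ONCE (✓ `exists_flat_lift_of_firstOrder` :156),
at `(A, I) = (O, 𝔪_O)` — a complete DVR and its PRINCIPAL maximal ideal `(ϖ)`.  So the whole S-D8-LIFT chain needs Grothendieck existence only for a
PRINCIPAL ideal of definition, the form res-type-027 g23 is proving as a THEOREM (E♭ `grothendieckExistence_principal`, desk R70 (i), from the tree's ✓
`GrothendieckExistenceProper.exists_coh_iso_cmplTower_of_isProper`).  This file is the consumer side, landed ahead of E♭ and independent of its proof: the day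
E♭ lands in the custody shape, `nodalHostedRoundFact_of_grothendieckExistencePrincipal grothendieckExistence_principal : NodalHostedRoundFact` is
hypothesis-free (a one-line lambda adapts any other binder order), and the 45th registration (desk R70 (ii) «F-88 RETIREMENT») can derive
`stub_elnat_nodalHostedRoundFact` without `stub_elnat_grothendieckExistence`.

WHAT.  ★ `nodalCurveLiftFact_of_grothendieckExistencePrincipal : (hGEp : «E♭ shape», inline) → NodalCurveLiftFact` and ★★
`nodalHostedRoundFact_of_grothendieckExistencePrincipal : (hGEp) → NodalHostedRoundFact` — the statements of the ✓ F-88 versions with the hypothesis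
replaced; PROOF byte for byte that of ✓ `nodalCurveLiftFact_of_grothendieckExistence` (the uniformiser lemma ✓ `uniformiser_notMem_sq_firstOrder` is
IMPORTED, not restated) except that the (F)-assembly restart is nose-w1's ✓ `exists_flat_lift_of_firstOrder_of_principal hGEp …` (same binder list) instead of
✓ `exists_flat_lift_of_firstOrder hGE …`.  All mathematical credits as in …NatNodalCurveLiftOfGE (res-L1-w45b-nose-w1 g5 (N-C1)–(N-C4), (N-C4♭);
res-L1-w45b-stub-2 g19 (N-C0)/(N-C7); res-type-027 (J1c programme, 𝓙/𝓥-calculus)); this seat adds nothing mathematical here beyond its own ✓ p699098.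
-/

set_option linter.dupNamespace false -- mandated namespace `Summit.<Summit>.<Problem>` of this single-conjunct summit
set_option linter.overlappingInstances false -- signatures carry `[IsDomain O] [IsDiscreteValuationRing O]`
-- `TopCat.Presheaf`/`Scheme.Modules` are not reducible (as in Mathlib's `AlgebraicGeometry/Modules` and the tree's `Modules/*`).
set_option backward.isDefEq.respectTransparency false

noncomputable section

open CategoryTheory CategoryTheory.Limits AlgebraicGeometry Opposite TopologicalSpace IsLocalRing
open Literature.AlgebraicGeometry.Resolution
open Literature.AlgebraicGeometry.Morphisms Literature.AlgebraicGeometry.Modules Literature.AlgebraicGeometry.Deformation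
open Literature.AlgebraicGeometry.HodgeTheory
open AlgebraicGeometry.Scheme.IdealSheafData
open Summit.ResolutionOfSingularities.ResolutionOfSingularities.Cruxes.EquisingularLift.StrataSplit

namespace Summit.ResolutionOfSingularities.ResolutionOfSingularities.Cruxes.EquisingularLiftNat.Sections

/-! ## The uniformiser is off `𝔪²` in the first infinitesimal neighbourhood -/

/-- ★ **THE DOOR-REGIME NODAL LIFT RESIDUE MODULO GROTHENDIECK EXISTENCE FOR PRINCIPAL IDEALS OF DEFINITION**:
`(hGEp : «E♭ shape», inline) → NodalCurveLiftFact`.  `hGEp` is, verbatim, the body of the named fact `GrothendieckExistence` (F-88) with the ideal of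
definition PRINCIPAL (`I := Ideal.span {a}`, universe `0`) — res-inputs-crit-1's custody shape for res-type-027's theorem E♭, byte-identical to
res-L1-w45b-nose-w1's `hGEp`.  Proof = ✓ `nodalCurveLiftFact_of_grothendieckExistence`'s with the (F)-assembly restarted through nose-w1's ✓
`exists_flat_lift_of_firstOrder_of_principal hGEp`.  See the module docstring.  [OURS · L1 W4.5b · counted 0] -/
theorem nodalCurveLiftFact_of_grothendieckExistencePrincipal
    (hGEp : ∀ ⦃A : Type⦄ [CommRing A] [IsNoetherianRing A] (a : A) [IsAdicComplete (Ideal.span {a}) A] ⦃X : Scheme.{0}⦄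
      (f : X ⟶ Spec (.of A)) [IsProper f] (T : ℕ → Scheme.{0}) (j : ∀ n, T n ⟶ infinitesimalNeighbourhood (Ideal.span {a}) f n)
      (s : ∀ n, T n ⟶ T (n + 1)), (∀ n, IsClosedImmersion (j n)) →
      (∀ n, IsPullback (s n) (j n) (j (n + 1)) (infinitesimalNeighbourhood.transition (Ideal.span {a}) f n)) →
        ∃ (T' : Scheme.{0}) (i : T' ⟶ X), IsClosedImmersion i ∧
          ∃ r : ∀ n, T n ⟶ T', ∀ n, IsPullback (r n) (j n) i (infinitesimalNeighbourhood.ι (Ideal.span {a}) f n)) :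
    NodalCurveLiftFact := by
  intro k _ _ O _ _ _ _ θ hθ P q X σ 𝓔 hXint hXnoeth hXreg h𝓔reg h𝓔flat h𝓔prop G j t hsq E hE h𝓔E Z hZ hZE hZfin hZdim hEdim hEreg hunobs hN4
  classical
  haveI := hXnoeth
  haveI : IsLocallyNoetherian G := P1VB.isLocallyNoetherian_of_modelSquare θ hθ (σ ≫ q) j t hsq
  obtain ⟨ϖ, hϖ⟩ := IsDiscreteValuationRing.exists_irreducible O
  have hker : RingHom.ker θ = maximalIdeal O := ker_eq_maximalIdeal_of_surjective θ hθ
  have hI : maximalIdeal O ≤ RingHom.ker θ := hker.ge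
  -- the ambient of (F): `W = V(𝓔)` over `Spec O`
  set w : 𝓔.subscheme ⟶ Spec (.of O) := 𝓔.subschemeι ≫ σ ≫ q with hw
  haveI : IsProper w := h𝓔prop
  haveI : Flat w := h𝓔flat
  haveI : IsLocallyNoetherian 𝓔.subscheme := LocallyOfFiniteType.isLocallyNoetherian 𝓔.subschemeι
  -- the closed immersion downstairs: `ι : Z̃ ⟶ Ẽ`
  have hle : vanishingIdeal (⟨E, hE⟩ : Closeds G) ≤ vanishingIdeal (⟨Z, hZ⟩ : Closeds G) :=
    vanishingIdeal_antimono (show (⟨Z, hZ⟩ : Closeds G) ≤ ⟨E, hE⟩ from hZE)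
  let ι : redSub G Z hZ ⟶ redSub G E hE := inclusion hle
  have hιfac : ι ≫ redSubι G E hE = redSubι G Z hZ := inclusion_subschemeι hle
  haveI : IsClosedImmersion ι :=
    @IsClosedImmersion.of_comp_isClosedImmersion _ _ _ ι (redSubι G E hE) inferInstance (by rw [hιfac]; infer_instance)
  haveI : IsLocallyNoetherian (redSub G E hE) := LocallyOfFiniteType.isLocallyNoetherian (redSubι G E hE)
  -- (P1) the model square of `W` with special fibre `Ẽ`
  let e' : redSub G E hE ⟶ (𝓔.comap j).subscheme := inclusion h𝓔E.le
  let e'' : (𝓔.comap j).subscheme ⟶ redSub G E hE := inclusion h𝓔E.ge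
  have he₁ : e' ≫ e'' = 𝟙 _ := by
    simp only [e', e'', inclusion_comp]; exact inclusion_id _
  have he₂ : e'' ≫ e' = 𝟙 _ := by
    simp only [e', e'', inclusion_comp]; exact inclusion_id _
  haveI : IsIso e' := ⟨e'', he₁, he₂⟩
  let jW : redSub G E hE ⟶ 𝓔.subscheme := e' ≫ subschemeComapHom j 𝓔
  let tW : redSub G E hE ⟶ Spec (.of k) := redSubι G E hE ≫ t
  have hsqE : IsPullback (subschemeComapHom j 𝓔) ((𝓔.comap j).subschemeι ≫ t) w (Spec.map (CommRingCat.ofHom θ)) := by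
    rw [hw]; exact (isPullback_subschemeComapHom j 𝓔).paste_vert hsq
  have hsq₀ : IsPullback e' tW ((𝓔.comap j).subschemeι ≫ t) (𝟙 _) :=
    IsPullback.of_horiz_isIso ⟨by simp only [tW, Category.comp_id, e']; rw [← Category.assoc, inclusion_subschemeι]⟩
  have hsqW : IsPullback jW tW w (Spec.map (CommRingCat.ofHom θ)) := by
    simpa only [Category.id_comp] using hsq₀.paste_horiz hsqE
  have hsqj₀ : IsPullback e' (redSubι G E hE) (𝓔.comap j).subschemeι (𝟙 G) :=
    IsPullback.of_horiz_isIso ⟨by simp only [Category.comp_id, e']; exact inclusion_subschemeι _⟩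
  have hsqj : IsPullback jW (redSubι G E hE) 𝓔.subschemeι j := by
    simpa only [Category.id_comp] using hsqj₀.paste_horiz (isPullback_subschemeComapHom j 𝓔)
  -- `jW` is a closed immersion; `Ẽ` and `Z̃` are quasi-compact
  haveI : IsClosedImmersion (Spec.map (CommRingCat.ofHom θ)) := IsClosedImmersion.spec_of_surjective _ hθ
  haveI hjWci : IsClosedImmersion jW := MorphismProperty.IsStableUnderBaseChange.of_isPullback hsqW.flip inferInstance
  haveI : CompactSpace ↥(𝓔.subscheme) := QuasiCompact.compactSpace_of_compactSpace w
  haveI : CompactSpace ↥(redSub G E hE) := QuasiCompact.compactSpace_of_compactSpace jW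
  haveI : CompactSpace ↥(redSub G Z hZ) := QuasiCompact.compactSpace_of_compactSpace ι
  -- (lci) `Z̃ ⊆ Ẽ` is Cartier (nose-w1), and the Čech datum from `DirStepUnobs`
  have hlci := NodalCurve.exists_affineOpens_isWeaklyRegular_ker' hZ hE ι hιfac (hEreg ι hιfac) (hEdim ι hιfac) hZdim
  have hH1 := hunobs ι hιfac
  -- the (N4) section
  obtain ⟨ψ, hψ⟩ := hN4 ι hιfac
  -- the bad points: closed and non-regular, finitely many
  set T : Set ↥(redSub G Z hZ) := {z | IsClosed ({z} : Set ↥(redSub G Z hZ)) ∧ ¬ IsRegularLocalRing ((redSub G Z hZ).presheaf.stalk z)} with hT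
  have hTfin : T.Finite := hZfin.subset fun z hz => hz.2
  -- LEVEL 0 of the engine: `jn := ι ≫ e₀`, flat over the field `O/𝔪`, with `𝟙` as its base change
  haveI hfE : IsClosedImmersion (fibreEmb (maximalIdeal O) w θ hI hsqW 0) := isClosedImmersion_fibreEmb _ w θ hI hsqW hθ 0
  have h0flat : Flat ((ι ≫ fibreEmb (maximalIdeal O) w θ hI hsqW 0) ≫ infinitesimalNeighbourhood.toSpec (maximalIdeal O) w 0) := by
    have heq : (ι ≫ fibreEmb (maximalIdeal O) w θ hI hsqW 0) ≫ infinitesimalNeighbourhood.toSpec (maximalIdeal O) w 0 =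
        (ι ≫ tW) ≫ Spec.map (CommRingCat.ofHom (fibreRingHom (maximalIdeal O) θ hI 0)) := by
      rw [Category.assoc, fibreEmb_toSpec]; simp only [tW, Category.assoc]
    rw [heq]
    have hbij : Function.Bijective (fibreRingHom (maximalIdeal O) θ hI 0) := by
      refine ⟨RingHom.lift_injective_of_ker_le_ideal _ (fun a ha => hI (Ideal.pow_le_self (Nat.succ_ne_zero 0) ha)) ?_, fun b => ?_⟩
      · rw [pow_one]; exact (IsLocalRing.eq_maximalIdeal (RingHom.ker_isMaximal_of_surjective θ hθ)).le
      · obtain ⟨a, rfl⟩ := hθ b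
        exact ⟨Ideal.Quotient.mk _ a, rfl⟩
    haveI : IsIso (CommRingCat.ofHom (fibreRingHom (maximalIdeal O) θ hI 0)) := (RingEquiv.ofBijective _ hbij).toCommRingCatIso.isIso_hom
    infer_instance
  haveI := h0flat
  have hs₀ : IsPullback (𝟙 _) ι ((ι ≫ fibreEmb (maximalIdeal O) w θ hI hsqW 0) ≫ infinitesimalNeighbourhood.ι (maximalIdeal O) w 0) jW := by
    have h1 : IsPullback (𝟙 _) ι (ι ≫ fibreEmb (maximalIdeal O) w θ hI hsqW 0) (fibreEmb (maximalIdeal O) w θ hI hsqW 0) :=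
      isPullback_id_of_mono ι (fibreEmb (maximalIdeal O) w θ hI hsqW 0)
    have h2 : IsPullback (𝟙 _) (ι ≫ fibreEmb (maximalIdeal O) w θ hI hsqW 0)
        ((ι ≫ fibreEmb (maximalIdeal O) w θ hI hsqW 0) ≫ infinitesimalNeighbourhood.ι (maximalIdeal O) w 0) (infinitesimalNeighbourhood.ι (maximalIdeal O) w 0) :=
      isPullback_id_of_mono _ _
    simpa [fibreEmb_ι] using h1.paste_horiz h2
  -- (first order) the flat lift `G'` of `Z̃` to `W₁`, off `𝔪²` at the bad points
  have hψT : ∀ z ∈ T, ∃ (U : (redSub G E hE).affineOpens) (hz : z ∈ ι ⁻¹ᵁ (U : (redSub G E hE).Opens)) (m : Γ(idealModule ι, (U : (redSub G E hE).Opens))),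
      IsUnit ((redSub G Z hZ).presheaf.germ (ι ⁻¹ᵁ (U : (redSub G E hE).Opens)) z hz
        (normalSectionsVal ι U (normalSheafSectionsEquiv ι _ ((normalSheaf ι).presheaf.map (homOfLE le_top).op ψ)) m)) :=
    fun z hz => hψ z hz.1 hz.2
  have hεT : ∀ z ∈ T, ((infinitesimalNeighbourhood (maximalIdeal O) w (0 + 1)).presheaf.Γgerm
        ((infinitesimalNeighbourhood.transition (maximalIdeal O) w 0).base ((fibreEmb (maximalIdeal O) w θ hI hsqW 0).base (ι.base z)))).hom
        (((infinitesimalNeighbourhood.toSpec (maximalIdeal O) w (0 + 1)).appTop).hom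
          ((Scheme.ΓSpecIso (.of (O ⧸ maximalIdeal O ^ (0 + 1 + 1)))).inv.hom (Ideal.Quotient.mk _ (ϖ ^ (0 + 1))))) ∉
      maximalIdeal _ ^ 2 := by
    intro z hz
    haveI : IsRegularLocalRing ((redSub G E hE).presheaf.stalk (ι.base z)) := hEreg ι hιfac z
    exact uniformiser_notMem_sq_firstOrder hθ hϖ hsqW hI 0 rfl (ι.base z)
  obtain ⟨G', hG', hG'flat, hgood⟩ := exists_firstOrder_lift_not_le_sq hθ hϖ hsqW hI ι hlci hH1 0 (ι ≫ fibreEmb (maximalIdeal O) w θ hI hsqW 0)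
    hs₀ ψ T hTfin hψT hεT
  -- (restart) the `O`-flat lift `C₀` on `W` with `C₀·𝒪_{W₁} = G'` and `C₀·𝒪_{Ẽ} = 𝓘_{Z̃}` (nose-w1's (N-C4): J1 + GE from `Y₁ = V(G')`)
  haveI := hG'flat
  have hres₁ : ∃ s₁ : redSub G Z hZ ⟶ G'.subscheme,
      IsPullback s₁ ι (G'.subschemeι ≫ infinitesimalNeighbourhood.ι (maximalIdeal O) w (0 + 1)) jW := by
    have hleK : G'.subschemeι.ker ≤ ((ι ≫ fibreEmb (maximalIdeal O) w θ hI hsqW 0) ≫ infinitesimalNeighbourhood.transition (maximalIdeal O) w 0).ker := by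
      rw [Scheme.IdealSheafData.ker_subschemeι, ← Scheme.IdealSheafData.map_ker, ← hG']
      exact G'.le_map_comap _
    let s₁ := IsClosedImmersion.lift G'.subschemeι _ hleK
    have hs₁ : s₁ ≫ G'.subschemeι = (ι ≫ fibreEmb (maximalIdeal O) w θ hI hsqW 0) ≫ infinitesimalNeighbourhood.transition (maximalIdeal O) w 0 :=
      IsClosedImmersion.lift_fac _ _ _
    have hsqs : IsPullback s₁ (ι ≫ fibreEmb (maximalIdeal O) w θ hI hsqW 0) G'.subschemeι (infinitesimalNeighbourhood.transition (maximalIdeal O) w 0) :=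
      (isPullback_of_isClosedImmersion _ G'.subschemeι s₁ (infinitesimalNeighbourhood.transition (maximalIdeal O) w 0) (by rw [hs₁])
        (by rw [Scheme.IdealSheafData.ker_subschemeι, hG'])).flip
    refine ⟨s₁, ?_⟩
    -- paste with `Z̃ = Z̃ ×_{W_0} W₀` (`hs₀`) turned around, and `W_0 → W_1 → W`
    have h3 : IsPullback (𝟙 _) G'.subschemeι (G'.subschemeι ≫ infinitesimalNeighbourhood.ι (maximalIdeal O) w (0 + 1))
        (infinitesimalNeighbourhood.ι (maximalIdeal O) w (0 + 1)) := isPullback_id_of_mono _ _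
    have h4 := hsqs.paste_horiz h3
    rw [Category.comp_id, infinitesimalNeighbourhood.transition_ι] at h4
    -- `h4 : IsPullback s₁ (ι ≫ e₀) (j₁' ≫ ι₁) (ι₀)`; now remove `e₀` using `hs₀` (base change of `Z̃` along `e₀` is `Z̃`)
    have h5 : IsPullback (𝟙 _) ι (ι ≫ fibreEmb (maximalIdeal O) w θ hI hsqW 0) (fibreEmb (maximalIdeal O) w θ hI hsqW 0) :=
      isPullback_id_of_mono ι (fibreEmb (maximalIdeal O) w θ hI hsqW 0)
    have h6 := h5.paste_horiz h4
    rw [Category.id_comp, fibreEmb_ι] at h6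
    exact h6
  obtain ⟨C₀, hC₀flat, hC₀G', hC₀comap⟩ := exists_flat_lift_of_firstOrder_of_principal hGEp O k θ hθ 𝓔.subscheme w (redSub G E hE) jW tW hsqW
    inferInstance inferInstance (redSub G Z hZ) ι inferInstance hlci hH1 G'.subscheme G'.subschemeι hG'flat hres₁
  rw [Scheme.IdealSheafData.ker_subschemeι] at hC₀G'
  -- the lift `l : Z̃ → V(C₀)` and its squares (as in F-88's (P3))
  let f : C₀.subscheme ⟶ X := C₀.subschemeι ≫ 𝓔.subschemeι
  let C : X.IdealSheafData := C₀.map 𝓔.subschemeι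
  have hCf : C = f.ker := rfl
  have hkerl : C₀.subschemeι.ker ≤ (ι ≫ jW).ker := by
    rw [ker_subschemeι, ← map_ker, ← hC₀comap]; exact le_map_comap _ _
  let l : redSub G Z hZ ⟶ C₀.subscheme := IsClosedImmersion.lift C₀.subschemeι (ι ≫ jW) hkerl
  have hlfac : l ≫ C₀.subschemeι = ι ≫ jW := IsClosedImmersion.lift_fac _ _ _
  have hsql : IsPullback ι l jW C₀.subschemeι :=
    isPullback_of_isClosedImmersion ι C₀.subschemeι l jW hlfac.symm (by rw [ker_subschemeι, hC₀comap])
  have hsqY : IsPullback l (ι ≫ tW) (C₀.subschemeι ≫ w) (Spec.map (CommRingCat.ofHom θ)) := hsql.flip.paste_vert hsqW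
  have hsqG : IsPullback l (ι ≫ redSubι G E hE) f j := hsql.flip.paste_vert hsqj
  haveI : IsProper (C₀.subschemeι ≫ w) := inferInstance
  haveI : Flat (C₀.subschemeι ≫ w) := hC₀flat
  haveI : IsLocallyNoetherian C₀.subscheme := LocallyOfFiniteType.isLocallyNoetherian C₀.subschemeι
  haveI hlci' : IsClosedImmersion l :=
    @IsClosedImmersion.of_comp_isClosedImmersion _ _ _ l C₀.subschemeι inferInstance (by rw [hlfac]; infer_instance)
  -- (regularity) `V(C₀)` is regular
  have hC₀reg : Scheme.IsRegular C₀.subscheme := by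
    refine Scheme.isRegular_of_forall_over_closedPoint (C₀.subschemeι ≫ w) fun y hy => ?_
    -- `y` lies on the fibre: `y = l z`
    have hyr : y ∈ Set.range l.base := by
      rw [range_eq_preimage_of_isPullback hsqY, range_specMap_of_surjective_of_field θ hθ]; exact hy
    obtain ⟨z, rfl⟩ := hyr
    -- `z` specialises inside `Z̃` to a closed point `z₀`; regularity generises
    obtain ⟨z₀, hzz₀, hz₀⟩ := exists_specializes_isClosed z
    refine isRegularLocalRing_stalk_of_specializes (hzz₀.map l.continuous) ?_
    by_cases hzreg : IsRegularLocalRing ((redSub G Z hZ).presheaf.stalk z₀)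
    · -- a regular point of `Z̃`: flat + regular fibre stalk (nose-w1's (N-C2′))
      exact ModelSquare.isRegularLocalRing_stalk_of_isRegularLocalRing_fibre_stalk O θ hθ (C₀.subschemeι ≫ w) l (ι ≫ tW) hsqY z₀
    · -- a node: the local equation of the lift is not in `𝔪²`
      have hzT : z₀ ∈ T := ⟨hz₀, hzreg⟩
      rw [isRegularLocalRing_stalk_subscheme_iff]
      -- the three names of the point `x = jW (ι z₀)` of `W`
      have hPa : C₀.subschemeι.base (l.base z₀) = jW.base (ι.base z₀) := by
        rw [← Scheme.Hom.comp_apply, hlfac, Scheme.Hom.comp_apply]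
      have hPc : (infinitesimalNeighbourhood.ι (maximalIdeal O) w (0 + 1)).base
          ((infinitesimalNeighbourhood.transition (maximalIdeal O) w 0).base ((fibreEmb (maximalIdeal O) w θ hI hsqW 0).base (ι.base z₀))) =
          jW.base (ι.base z₀) := by
        rw [← Scheme.Hom.comp_apply, ← Scheme.Hom.comp_apply, infinitesimalNeighbourhood.transition_ι, fibreEmb_ι]
      -- `dim 𝒪_{W,x} = 2 + 1` and `dim 𝒪_{W,x}/C₀ = 1 + 1`
      haveI : IsRegularLocalRing ((redSub G E hE).presheaf.stalk (ι.base z₀)) := hEreg ι hιfac z₀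
      have hdimB : ringKrullDim (𝓔.subscheme.presheaf.stalk (jW.base (ι.base z₀))) = ((2 : ℕ) : WithBot ℕ∞) + 1 := by
        rw [ModelSquare.ringKrullDim_stalk_eq_fibre_add_one O θ hθ w jW tW hsqW (ι.base z₀), hEdim ι hιfac z₀ hz₀]
      have hdimQ : ringKrullDim (𝓔.subscheme.presheaf.stalk (C₀.subschemeι.base (l.base z₀)) ⧸
          stalkIdeal C₀ (C₀.subschemeι.base (l.base z₀))) = ((1 : ℕ) : WithBot ℕ∞) + 1 := by
        rw [← ringKrullDim_stalk_subscheme, ModelSquare.ringKrullDim_stalk_eq_fibre_add_one O θ hθ (C₀.subschemeι ≫ w) l (ι ≫ tW) hsqY z₀,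
          hZdim z₀ hz₀]
      rw [hPa] at hdimQ ⊢
      -- an element of `C₀·𝒪_{W,x}` off `𝔪²`, from `G' ⊄ 𝔪²` at the point of `W₁`
      have hF : ∃ F ∈ stalkIdeal C₀ (jW.base (ι.base z₀)), F ∉ maximalIdeal (𝓔.subscheme.presheaf.stalk (jW.base (ι.base z₀))) ^ 2 := by
        have hg := hgood z₀ hzT
        rw [← hC₀G', stalkIdeal_comap_eq_map_stalkMap] at hg
        rw [← hPc]
        by_contra hall
        push Not at hall
        apply hg
        rw [Ideal.map_le_iff_le_comap]
        intro F hF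
        have h2 := hall F hF
        rw [Ideal.mem_comap]
        have hle2 : (maximalIdeal (𝓔.subscheme.presheaf.stalk ((infinitesimalNeighbourhood.ι (maximalIdeal O) w (0 + 1)).base
              ((infinitesimalNeighbourhood.transition (maximalIdeal O) w 0).base ((fibreEmb (maximalIdeal O) w θ hI hsqW 0).base (ι.base z₀))))) ^ 2).map
            ((infinitesimalNeighbourhood.ι (maximalIdeal O) w (0 + 1)).stalkMap
              ((infinitesimalNeighbourhood.transition (maximalIdeal O) w 0).base ((fibreEmb (maximalIdeal O) w θ hI hsqW 0).base (ι.base z₀)))).hom ≤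
            maximalIdeal _ ^ 2 := by
          rw [Ideal.map_pow]
          exact Ideal.pow_right_mono (IsLocalRing.map_maximalIdeal_le _) 2
        exact hle2 (Ideal.mem_map_of_mem _ h2)
      obtain ⟨F, hF𝔞, hF2⟩ := hF
      haveI : IsRegularLocalRing (𝓔.subscheme.presheaf.stalk (jW.base (ι.base z₀))) := h𝓔reg _
      have hxsupp : jW.base (ι.base z₀) ∈ C₀.support := by
        rw [← hPa, ← SetLike.mem_coe, ← Scheme.IdealSheafData.range_subschemeι]; exact ⟨_, rfl⟩
      have h𝔞le : stalkIdeal C₀ (jW.base (ι.base z₀)) ≤ maximalIdeal _ := (mem_support_iff_stalkIdeal_le _ _).mp hxsupp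
      have h𝔞 : stalkIdeal C₀ (jW.base (ι.base z₀)) ≠ ⊤ := fun h => (maximalIdeal.isMaximal _).ne_top (top_le_iff.mp (h ▸ h𝔞le))
      have hdim : ringKrullDim (𝓔.subscheme.presheaf.stalk (jW.base (ι.base z₀)) ⧸ stalkIdeal C₀ (jW.base (ι.base z₀))) + 1 =
          ringKrullDim (𝓔.subscheme.presheaf.stalk (jW.base (ι.base z₀))) := by
        rw [hdimQ, hdimB]; rfl
      exact (isRegularLocalRing_quotient_of_mem_of_not_mem_sq hF𝔞 (h𝔞le hF𝔞) hF2 h𝔞 hdim).2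
  -- (transport) to the stage, as F-88's (P3)/(P5)
  haveI hfci : IsClosedImmersion f := IsClosedImmersion.comp C₀.subschemeι 𝓔.subschemeι
  haveI : IsIso f.toImage := by infer_instance
  have hCreg : Scheme.IsRegular f.image := Scheme.IsRegular.of_isOpenImmersion (inv f.toImage) hC₀reg
  refine ⟨C, ?_, ?_, ?_, ?_, ?_⟩
  · calc 𝓔 = (⊥ : 𝓔.subscheme.IdealSheafData).map 𝓔.subschemeι := by rw [Scheme.IdealSheafData.map_bot, ker_subschemeι]
      _ ≤ C := map_mono _ bot_le
  · exact hCreg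
  · have h1 : f.toImage ≫ C.subschemeι ≫ σ ≫ q = C₀.subschemeι ≫ w := by
      change f.toImage ≫ f.imageι ≫ σ ≫ q = _
      rw [f.toImage_imageι_assoc, hw]; simp only [f, Category.assoc]
    have h2 : Flat (f.toImage ≫ C.subschemeι ≫ σ ≫ q) := by rw [h1]; exact hC₀flat
    exact (MorphismProperty.cancel_left_of_respectsIso @Flat f.toImage _).mp h2
  · rw [hCf, ← ker_fst_of_isClosedImmersion f j, ← hsqG.flip.isoPullback_inv_fst, Scheme.Hom.ker_comp_of_isIso, hιfac,
      ker_subschemeι]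
  · intro x hx hcodim
    have hx' : x ∈ Set.range C.subschemeι := by rw [range_subschemeι]; exact hx
    obtain ⟨s, rfl⟩ := hx'
    haveI := hXreg (C.subschemeι s)
    exact exists_twoFrame_of_codim_two C hCreg s hcodim

/-- ★★ **S-D8-LIFT MODULO GROTHENDIECK EXISTENCE FOR PRINCIPAL IDEALS OF DEFINITION: `(hGEp : «E♭ shape», inline) → NodalHostedRoundFact`** —
the 43rd/44th registration's `stub_elnat_nodalHostedRoundFact` (✓ …NatNodalHostedRoundDefs) from the principal-ideal instance of Grothendieck existence
alone: `nodalCurveLiftFact_of_grothendieckExistencePrincipal` composed with ✓ `nodalHostedRoundFact_of_nodalCurveLiftFact` (…NatNodalHostedRoundOfCurveLift).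
With res-type-027's THEOREM E♭ `grothendieckExistence_principal` (desk RULING R70 (i)) for `hGEp` this is hypothesis-free; until then nothing about the
door changes and F-88 is not reported as paid.  [OURS · L1 W4.5b · S-D8-LIFT / R70 (ii) TWIN-2; counted 0; nothing of EL♮(3) is proved here] -/
theorem nodalHostedRoundFact_of_grothendieckExistencePrincipal
    (hGEp : ∀ ⦃A : Type⦄ [CommRing A] [IsNoetherianRing A] (a : A) [IsAdicComplete (Ideal.span {a}) A] ⦃X : Scheme.{0}⦄
      (f : X ⟶ Spec (.of A)) [IsProper f] (T : ℕ → Scheme.{0}) (j : ∀ n, T n ⟶ infinitesimalNeighbourhood (Ideal.span {a}) f n)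
      (s : ∀ n, T n ⟶ T (n + 1)), (∀ n, IsClosedImmersion (j n)) →
      (∀ n, IsPullback (s n) (j n) (j (n + 1)) (infinitesimalNeighbourhood.transition (Ideal.span {a}) f n)) →
        ∃ (T' : Scheme.{0}) (i : T' ⟶ X), IsClosedImmersion i ∧
          ∃ r : ∀ n, T n ⟶ T', ∀ n, IsPullback (r n) (j n) i (infinitesimalNeighbourhood.ι (Ideal.span {a}) f n)) :
    NodalHostedRoundFact :=
  nodalHostedRoundFact_of_nodalCurveLiftFact (nodalCurveLiftFact_of_grothendieckExistencePrincipal hGEp)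

end Summit.ResolutionOfSingularities.ResolutionOfSingularities.Cruxes.EquisingularLiftNat.Sections

end
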